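import Mathlib
import HarnessLib
import HarnessLib.Audit
import Summits.RiemannHypothesis.Statement
import Summits.RiemannHypothesis.RiemannHypothesis.Theorems.JensenPolynomialsChainDefs
import Literature.NumberTheory.LFunctions.ZetaLogDerivSeries
import Summits.RiemannHypothesis.RiemannHypothesis.Theorems.JensenPolynomialsSqrtLogRange
import HarnessLib.Audit.Status.Attr

/-!
Route: JensenChainBand

CLOSED (proved) 2026-08-26T22:03:33Z by operator:999:741651 — reason: proved:Summit.RiemannHypothesis.RiemannHypothesis.Theorems.JensenPolynomials.KimLee.jensenSqrtLogRangeTwenty_holds. The file is kept as the record of this route; refuted decls are indexed as negative knowledge (`ledger negatives`).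

# Route JensenChainBand — Effective Kim–Lee by Jensen chains — J^{d,n}_γ hyperbolic whenever
20·√d·log n ≤ n (n ≥ 20000)

RUNG ROUTE (D-0059/D-0061, ladder RH column JENSEN, rung J-P(P1″) «√d·log d hyperbolicity range on
the zero side»; label «closes rung J-P(P1″)», proof-of-data, never summit credit; RH-FREE; WHAT THIS
IS NOT: nothing here bears on the truth of RH — a hyperbolicity range with N(d) → ∞ is inside
Farmer's class by design). It suffices to show X = X1 ∧ X2 on the auxiliary entire function G(z) =
ξ(½+√z) (tree: `xiSq`, whose Taylor coefficients at 0 are γ(k)·k!/8 with γ = `xiTaylorCoeff`): X1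
(`XiSqChainAnchor`, the mechanism) — for every chain z₀,…,zₙ of zeros of G, G′, …, G⁽ⁿ⁾ with path
‖z₀‖ + Σ‖z_k − z_{k+1}‖ ≤ B one has ‖G(0)‖ = ‖ξ(½)‖ ≤ Γ((1+e²)B)·e^{−2(n+1)}, Γ(r) =
8e⁶·exp(4(½+√r)·log(3/2+√r)) the explicit order-½ majorant of G on ‖z‖ ≤ r; X2 (`XiSqChainBudget`,
the closed numeric inequality) — Γ((1+e²)·chainSpan n (R n))·e^{−2(n+1)} < 2/5 for n ≥ 20000, R n =
(n/log n)²/64. With the supports (every NON-REAL zero w of G⁽ⁿ⁾ ends a Ki–Kim backward Jensen chain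
of path ≤ chainSpan n ‖w‖; 2/5 ≤ ‖ξ(½)‖; idea-2's kernel-checked wide-band step; one line of real
arithmetic) X gives: G⁽ⁿ⁾ has no non-real zero in ‖w‖ < R n for n ≥ 20000, hence J^{d,n}_γ is
hyperbolic whenever 2d + (1+√n)√(2d) ≤ R n, in particular whenever 20·√d·log n ≤ n — the leaf
`JensenSqrtLogRangeTwenty` (N(d) ≲ C√d·log d: Kim–Lee 2021 Thm 1 made EFFECTIVE and log-sharp; the
NEW cells are those with d > 10⁶ — below that every shift is already kernel-known from
`riemannHypothesisUpTo_1000` via `jensenPoly_xiTaylorCoeff_splits_allShifts_of_le_1e6'` — and n ≥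
20√d·log n, e.g. d = 10⁶+1 from n = 248 461 on and d = 10⁷ from n ≈ 8.65·10⁵ on, where the cubic
rung J-P(P1′) needs n ≥ 2d³ = 2·10²¹). Realises crux-idea card `effective-kim-lee`
(rh-jensen-idea-2, APPROACH B of route-RiemannHypothesis-JensenPolynomials' header) as its own rung.
Lean: `Summit.RiemannHypothesis.RiemannHypothesis.Theses.JensenChainBand.XiSqChainAnchor ∧
Summit.RiemannHypothesis.RiemannHypothesis.Theses.JensenChainBand.XiSqChainBudget`

## Assembly
Pure logic plus one monotonicity: from `XiSqNonrealZeroChain`, `XiSqChainAnchor` (with B = chainSpan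
n (chainRadius n), using chainSpan n ‖w‖ ≤ chainSpan n (chainRadius n) for ‖w‖ < chainRadius n),
`XiSqChainBudget` and `XiSqZeroLowerBound` a non-real zero of G⁽ⁿ⁾ of norm < chainRadius n, n ≥
20000, yields 2/5 ≤ ‖G 0‖ < 2/5 — so `XiDerivNonrealZeroBeyond chainFloor` (this 20-line step is
PROVED inside glue.lean, kernel-checked in the emulation); `JensenWideBandOfChainFloor` turns it
into the band, `ChainBandArith` puts the leaf's hypothesis inside the band; `chainFloor_of_le`
identifies chainFloor n with chainRadius n for n ≥ 20000. The deciding theorem `closes :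
XiSqChainAnchor → XiSqChainBudget → XiSqNonrealZeroChain → XiSqZeroLowerBound →
JensenWideBandOfChainFloor → ChainBandArith → JensenSqrtLogRangeTwenty` consumes all six items.

CLOSES_TARGET: closes rung J-P(P1'') of RiemannHypothesis: Summit.RiemannHypothesis.RiemannHypothesis.Theorems.JensenPolynomials.JensenSqrtLogRangeTwenty (D-0061; not the summit Statement) — the deciding theorem of this route concludes that registered leaf instead of the Statement decl `RiemannHypothesis` (class rung: servable and labelled, never counted as concluding the summit Statement).

Rationale: WHY THIS LINE. Mechanism (complex analysis of real entire functions of order < 2, transplanted from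
the STRIP setting of Kim 1996 / Ki–Kim 2000 / Farmer 2022 — tree
`Literature.Barriers.RiemannHypothesis.norm_le_exp_neg_of_nonreal_zero`,
`Farmer2022_kimTheorem_holds`, both PROVED — to the PARABOLA setting z = (s−½)²): n differentiations
of G consume its n lowest zeros EFFECTIVELY — a non-real zero w of G⁽ⁿ⁾ starts a backward Jensen
chain (tree `exists_jensen_chain`, `chain_variation_le`, KiKim2000 §2) down to a zero z₀ of G, whose
imaginary part is ≤ √‖z₀‖ because the zeros of G are images of the critical strip (tree
`xiSq_zeros_mem_sector`, idea-2's sorry-free `abs_im_le_sqrt_norm_of_xiSq_eq_zero`); Gontcharoff's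
interpolation estimate at the anchor 0 (tree `Literature.Analysis.Complex.gontcharoff_norm_le`) with
Cauchy's bound at radius e²·B and the explicit order bound ‖ξ(s)‖ ≤ 8e⁶exp(4‖s‖log(1+‖s‖)) (tree
`norm_riemannXi_le_of_half_le_re`, transported by `xiSq_eq`) then forces ‖ξ(½)‖ ≤ Γ·e^{−2(n+1)},
absurd below the radius (n/log n)²/64 (float margin 1573 nats at n = 20000, growing like 0.55·n).
Sources: KimLee2021 (arXiv:2105.05386, Thm 1: N(Ξ₀;d) = O(d^{1/2+ε}) INEFFECTIVE, via Kim's sector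
theorem), KiKim2000, Kim1996, Farmer2022, CravenCsordasSmith1987 (Pólya–Wiman),
GORZPNAS2019/Holland2026/Osullivan2021 (coefficient-side ranges e^{d}, K·d⁵ ineffective, d^{3/4}
model). What it does that prior routes do not: route-RiemannHypothesis-JensenPolynomials (P1′) works
on the COEFFICIENT side (GORTTW Hermite expansion + sign test) and is capped at n ≍ d³ by the
measured onset of the ℓ¹ sign test; this line never expands γ(n±j)/γ(n) and reaches n ≍ √d·log d;
the negatives index has no statement about zeros of derivatives of xiSq.

RANKED CRUXES. #2 XiSqChainAnchor (crux) — ANCHOR DECAY ALONG A CHAIN (the mechanism; card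
effective-kim-lee steps (iii)–(iv)): for every n, every sequence z : ℕ → ℂ with G⁽ᵏ⁾(z k) = 0 for k
≤ n (G = xiSq), and every B > 0 with ‖z 0‖ + Σ_{k<n} ‖z k − z (k+1)‖ ≤ B: ‖G(0)‖ ≤
xiGrowthBound((1+e²)·B) · exp(−2(n+1)), where xiGrowthBound r = 8e⁶·exp(4(½+√r)·log(3/2+√r)). Proof
plan: all z k and 0 lie in the convex set K = closedBall 0 B; Cauchy on spheres of radius e²B around
points of K bounds ‖G⁽ⁿ⁺¹⁾‖ on K by (n+1)!·Γ/(e²B)ⁿ⁺¹ with Γ = sup of ‖G‖ on ‖v‖ ≤ (1+e²)B ≤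
xiGrowthBound((1+e²)B) (‖½+√v‖ ≤ ½+√r, log(1+‖s‖) ≤ log(3/2+√r), re(½+√v) ≥ ½ on the principal
branch); Gontcharoff gives ‖G 0‖ ≤ (n+1)!Γ/(e²B)ⁿ⁺¹ · Bⁿ⁺¹/(n+1)! = Γ·e^{−2(n+1)}. [difficulty: M]
(why it might fail: only by mis-transport of the growth bound through the square root: ‖xiSq v‖ ≤
xiGrowthBound r needs re(½+√v) ≥ ½ (principal branch, true) and ‖½+√v‖ ≤ ½+√‖v‖; if `xiSq_eq` used
another branch the constant 8e⁶ would change, not the shape.) [KiKim2000, Kim1996, Farmer2022,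
KimLee2021]
#3 XiSqChainBudget (crux) — THE BUDGET (closed numeric inequality, no ξ inside): for every n ≥
20000, xiGrowthBound((1+e²)·chainSpan n (chainRadius n)) · exp(−2(n+1)) < 2/5, where chainRadius n =
(n/log n)²/64 and chainSpan n t = (1+√n+√t)(2(1+√n)+√t). In logs: log 8 + 6 + 4(½+√r)log(3/2+√r) −
2(n+1) < log(2/5) with √r = √(1+e²)·√((1+√n+√R)(2+2√n+√R)), √R = (n/log n)/8. [difficulty: S] (why
it might fail: float margin is 1573 nats at n = 20000 (the minimum over n ≥ 20000; first true at n =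
16108) and ≥ 0.55·n asymptotically (coefficient 4·√(1+e²)/8 = 1.448 < 2); it fails only if a
prover's interval bounds for log/√ at n ≍ 2·10⁴ lose > 1500 nats — i.e. not mathematically, only by
clumsy typing.) [KiKim2000, KimLee2021]
#9 XiSqNonrealZeroChain (support) — EVERY NON-REAL ZERO OF G⁽ⁿ⁾ ENDS A SHORT CHAIN: if G⁽ⁿ⁾(w) = 0
and Im w ≠ 0 then there is z : ℕ → ℂ with G⁽ᵏ⁾(z k) = 0 (k ≤ n) and ‖z 0‖ + Σ_{k<n}‖z k − z (k+1)‖ ≤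
chainSpan n ‖w‖. Proof plan (80 % already sorry-free in rh-jensen-idea-2/NegationLensSketch.lean
`xiDerivZerosNearReal_holds`): WLOG Im w > 0 (else conjugate, `xiSq_conj`); `exists_jensen_chain`
(hyps: `differentiable_xiSq`, `norm_xiSq_le`, `xiSq_ofReal_im`, `iteratedDeriv_xiSq_ne_zero`) gives
the chain ending at w; `chain_variation_le` gives V ≤ Im z₀·(1+√n); Im z₀ ≤ √‖z₀‖
(`abs_im_le_sqrt_norm_of_xiSq_eq_zero`); ‖z₀‖ ≤ ‖w‖ + V; with s = 1+√n, t = ‖w‖, q = √‖z₀‖: q² ≤ t +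
s·q ⇒ q ≤ s + √t ⇒ path = q² + V ≤ (s+√t)(2s+√t). [difficulty: M] [KiKim2000,
CravenCsordasSmith1987]
#9 XiSqZeroLowerBound (support) — THE ANCHOR IS NOT SMALL: 2/5 ≤ ‖G(0)‖ = ‖ξ(½)‖ (true value
0.49712…; ξ(½) = −Γ(¼)ζ(½)/(8π^{1/4}), or ξ(½) = 8∫₀^∞Φ(t)dt with the tree's kernel Φ; in tree today
only `riemannXi_half_re_pos`, `xiTaylorCoeff_zero_pos`). Kernel numerics: a certified lower Riemann
sum of Φ on [0, 1] (Φ is positive and decreasing), or interval bounds for Γ(¼) and ζ(½).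
[difficulty: M] [Polya1927Crelle, CsordasNorfolkVarga1986]
#9 JensenWideBandOfChainFloor (support) — WIDE BAND FROM THE FLOOR (idea-2's kernel-checked
`wideBand_of_beyond`, instantiated at R = chainFloor; port job): if G⁽ⁿ⁾ has no non-real zero of
norm < chainFloor n for every n, then J^{d,n}_γ splits over ℝ whenever 2d + (1+√n)·√(2d) ≤
chainFloor n (ingredients, all sorry-free on HOME: real zeros of G⁽ⁿ⁾ are ≤ 0 — Laguerre/sector step
`jensenShiftSector_holds`; the Jensen polynomial of the shifted Taylor sequence is hyperbolic once
the first d+1 relevant zeros are real — `xiDerivZerosNearReal_holds`; `jensenPoly` rescaling by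
k!/8). [difficulty: M] [KimLee2021, CravenCsordasSmith1987, GORZPNAS2019]
#9 ChainBandArith (support) — LEAF ARITHMETIC: for n ≥ 20000 and 20·√d·log n ≤ n one has 2d +
(1+√n)·√(2d) ≤ (n/log n)²/64 (√d ≤ n/(20 log n); it suffices that 2/400 + √2(1+√n)·log n/(20n) ≤
1/64, i.e. (1+√n)·log n ≤ 0.1503·n, true from n ≥ 2927; slack factor 2.25 at n = 20000).
[difficulty: S] [KimLee2021]

TWO-LAYER PLAN. Foreseen split of `XiSqChainAnchor` (only if a prover asks): A1 growth transport `∀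
r ≥ 0, ∀ v, ‖v‖ ≤ r → ‖xiSq v‖ ≤ xiGrowthBound r` and A2 the generic chain-decay lemma `IsXiSqChain
n z → chainPath n z ≤ B → 0 < B → (∀ v, ‖v‖ ≤ (1+e²)B → ‖xiSq v‖ ≤ Γ) → ‖xiSq 0‖ ≤ Γ·e^{−2(n+1)}`
with glue A1 → A2 → XiSqChainAnchor (one line; this is the BC3 skeleton). No other split foreseen.

KILL CRITERIA. A refutation of `XiSqChainBudget` (a specific n ≥ 20000 violating the inequality)
closes the route outright (close --reason refuted:XiSqChainBudget) — but then the same line re-opens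
with a larger threshold, so the informative kill is a refutation of `XiSqChainAnchor` (impossible
unless the growth transport is mis-typed: pivot = restate with the corrected constant) or of the
support `XiSqNonrealZeroChain` (a non-real zero of some G⁽ⁿ⁾ with no short chain — would contradict
Ki–Kim's Jensen-disc lemma as PROVED in tree, so it can only expose a typing slip in chainSpan:
pivot = corrected span, budget re-run). The route is mooted (superseded) if a zero-free band of
radius ≫ (n/log n)² for G⁽ⁿ⁾ lands by another method (idea-1's annulus realification
`XiDerivBandRealLazy`), and it is NOT mooted by the cubic rung closing (P1′ ⊂ P1″ for n ≥ 20000 only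
up to d ≤ 27 at n = 40 000).

NOT DECOMPOSED YET. The growth transport through √ (layer-2 child A1 above), the Cauchy-on-spheres
bookkeeping inside `XiSqChainAnchor`, the interval arithmetic of `XiSqChainBudget` (one
`norm_num`/`Real.log` bound chain at n = 20000 plus monotonicity in n — the prover chooses the cut),
and the numerics of ‖ξ(½)‖ ≥ 2/5 are deliberately left to the provers; the conjugation normalisation
(Im w < 0) inside `XiSqNonrealZeroChain` is a three-line reduction via `xiSq_conj`.

CHEAPEST FALSIFIER. The budget inequality at n = 20000 in floating point — RUN (folder budget.py,
emul check): log-margin +1572.98 nats at n = 20000, +1572.56 at 19 999… first positive at n = 16108,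
minimum over [20000, 3·10⁵] at n = 20000, positive on a geometric grid to 10³⁰⁰ (asymptotic slope (2
− 4√(1+e²)/8)·n = 0.552·n); arithmetic support slack 2.255 (in units of d_max) at n = 20000,
increasing. Second cheapest: the chain-span algebra q² ≤ t + (1+√n)q ⇒ path ≤ (1+√n+√t)(2(1+√n)+√t)
— checked by hand twice and exercised (with different constants) sorry-free in idea-2's
`xiDerivZerosNearReal_holds`.

NUMBERS. Radius constant 1/64 and threshold 20000: budget needs K > 8(1+e²)·(asymptotic coefficient
condition is 4√((1+e²)/K) < 2 ⇔ K > 4(1+e²) = 33.6; K = 64 gives slope 0.552) and n ≥ 16108 at K =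
64; leaf constant 20: 2d + (1+√n)√(2d) ≤ (n/log n)²/64 under √d ≤ n/(20 log n) needs (1+√n)log n/n ≤
0.1503 (true from n = 2927). Growth constants 8e⁶, 4, from `norm_riemannXi_le_of_half_le_re`
(RiemannXiOrderProofs.lean:143). Anchor ‖ξ(½)‖ = 0.497120778… (needs only ≥ 2/5). Comparison: GORTTW
N(d) ≤ 10^{2d+5} (coefficient side, effective), Kim–Lee O(d^{1/2+ε}) (ineffective), Holland 2026
K·d⁵ ≤ n³log²n (K ineffective), this leaf N(d) ≤ min{n ≥ 20000 : n/log n ≥ 20√d} ≍ 20√d·log d; known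
regime of the leaf: d ≤ 10⁶, all n (`jensenPoly_xiTaylorCoeff_splits_allShifts_of_le_1e6'`, from the
kernel fact `riemannHypothesisUpTo_1000`) — the route does not use it (the chain argument is uniform
in d), the first genuinely new cell is d = 10⁶+1, n = 248 461, i.e. n ≥ 2.5·10⁵.

DEFINITION REQUESTS. None for Literature. The route's vocabulary (leaf `JensenSqrtLogRangeTwenty`,
`XiDerivNonrealZeroBeyond`, `JensenWideBandBelow`, `chainRadius`, `chainFloor`, `IsXiSqChain`,
`chainPath`, `chainSpan`, `xiGrowthBound`) is the definitions-only file
`Summits/RiemannHypothesis/RiemannHypothesis/Theorems/JensenPolynomialsChainDefs.lean` (HOME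
rh-jensen/rh-jensen-theory/g9/, sha16 0ef7af6d859eb8c1, farm rc 0), to be landed by a prover seat
before open (theory seat files no proposals).

Novelty: Searches (2026-08-26): `lit search --hybrid "Jensen polynomials Riemann xi function hyperbolicity
effective bound Kim Lee derivatives nonreal zeros"` (12 docs: [corpus:paper:arxiv-1402.2795]
strip-preserving operators, Titchmarsh/Ivić/Edwards pages — none on effective N(d)); `lit search
"Jensen polynomials hyperbolicity xi derivatives effective" --source all` (local 2:
[corpus:paper:arxiv-1910.01227 p.2–3] GORTTW, [corpus:paper:arxiv-2108.01827 p.13]; remote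
crossref/arxiv 7: Planat 2026 doi:10.20944/preprints202604.1239.v2 «asymptotic hyperbolicity …
finite-strip obstruction», Larson–Wagner 2019, O'Sullivan — none effective-Kim–Lee; openalex/s2
rate-limited 429); `lit galaxy search "Jensen polynomial|Kim and Lee|nonreal zeros of the
derivatives" --star all` (26 rows, 0 relevant: no hits in galaxy); idea-2's card searches of
2026-08-26 (corpus fts+vec, galaxy pdf, `lit citing arxiv:2105.05386` → 0) re-read; `lean
search`/tree: `kimLee_thm1` (named fact, ineffective), `gorttw_thm1_1`,
`Farmer2022_kimTheorem_holds` (strip, proved), no decl bounding non-real zeros of iteratedDeriv n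
xiSq.
Nearest prior art found: KimLee2021 (arXiv:2105.05386 = JKMS 59 (2022), Thm 1: N(Ξ₀;d) =
O(d^{1/2+ε}), ineffective, via Kim's sector theorem — «our proof gives no information about the
Jensen polynomials considered»); KiKim2000 §2 (the chain + Gontcharoff engine, strip setting,
qualitative); Holland2026 (arXiv:2608.08682 Thm 1.1, ineffective K); in-house:
route-RiemannHypothesis-JensenPolynomia  [refs: 10.20944/preprints202604.1239.v2, 2105.05386, 2608.08682, paper:arxiv-1402.2795, paper:arxiv-1910.01227, paper:arxiv-2108.01827, doi:10.20944/preprints202604.1239.v2, arxiv:2105.05386, KimLee2021, KiKim2000, Holland2026]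

Barriers (technique_class: jensen-chain, gontcharoff-growth, zero-side-band): - technique_class: jensen-chain, gontcharoff-growth, zero-side-band
- Literature.Barriers.RiemannHypothesis.JensenPolynomials: it does not evade it and does not try —
`Farmer2022_kimTheorem`/`GORZ2019_thm3_corollary` say hyperbolicity for all large shifts n ≥ N(d)
holds for every real entire function of order < 2 with zeros in a strip, so it carries no
information on RH; this route closes a RUNG LEAF (class «closes rung J-P(P1″)», proof-of-data) that
is exactly such a large-shift statement, made quantitative; the bet is the ladder's, not an
inference toward RH. The line in fact USES the barrier's own engine
(`norm_le_exp_neg_of_nonreal_zero`, Kim's proof as typed in `JensenPolynomialsKimProofs`) as its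
mechanism.
- Literature.Barriers.RiemannHypothesis.JensenPolynomialsSqrt: inside/irrelevant — the cosh√
witnesses show order-< 1 functions with non-hyperbolic low rows; the route never passes from large
shifts to shift 0 or small n (n ≥ 20000 throughout).
- Literature.Barriers.RiemannHypothesis.JensenPolynomialsShiftUniform: inside, same placement as
Sqrt (the coshSq / cone family of `JensenPolynomialsCone.lean`): the band n ≥ 20000 ∧ 20·√d·log n ≤
n is compatible with every cone witness; nothing is claimed at a fixed n for all d, and the
complement region (for each fixed n, all large d) is exactly where non-hyperbolic rows may live.
- Literature.Barriers.RiemannHypothesis.JensenPolynomialsNarrow: inside, same placement as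
JensenPolynomials — no inference toward RH is drawn fro

History (route lifecycle, newest last):
- 2026-08-26T22:03:34Z · CLOSED proved — proved:Summit.RiemannHypothesis.RiemannHypothesis.Theorems.JensenPolynomials.KimLee.jensenSqrtLogRangeTwenty_holds (operator:999:741651)

sub-problem: RiemannHypothesis · status: closed(proved) · opened planner-rh-jensen-theory-g9-0 2026-08-26T21:22:45Z · rev 0 · ledger route-RiemannHypothesis-JensenChainBand
GENERATED by the gate from the ledger (D-0016/17). Provers cite these decls: `theorem foo : Summit.RiemannHypothesis.RiemannHypothesis.Theses.JensenChainBand.<Decl> := …` in Summits/RiemannHypothesis/RiemannHypothesis/Theorems/<Name>.lean.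
-/

namespace Summit.RiemannHypothesis.RiemannHypothesis.Theses.JensenChainBand

open scoped BigOperators Topology Manifold Classical MeasureTheory ProbabilityTheory Matrix InnerProductSpace ComplexConjugate ContinuousMap
open Filter Set Function TopologicalSpace MeasureTheory

attribute [summit_statement] _root_.Summit.RiemannHypothesis
attribute [summit_statement] _root_.Summit.RiemannHypothesis.RiemannHypothesis.Theorems.JensenPolynomials.JensenSqrtLogRangeTwenty

open Summit

/-- item stmt-RiemannHypothesis-19929 · crux · rank 2 · closed · moot by None · by planner
why it might fail: only by mis-transport of the growth bound through the square root: ‖xiSq v‖ ≤ xiGrowthBound r needs re(½+√v) ≥ ½ (principal branch, true) and ‖½+√v‖ ≤ ½+√‖v‖; if `xiSq_eq` used another branch the constant 8e⁶ would change, not the shape.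
sources: KiKim2000, Kim1996, Farmer2022, KimLee2021
[crux] ANCHOR DECAY ALONG A CHAIN (the mechanism; card effective-kim-lee steps (iii)–(iv)): for
every n, every sequence z : ℕ → ℂ with G⁽ᵏ⁾(z k) = 0 for k ≤ n (G = xiSq), and every B > 0 with ‖z
0‖ + Σ_{k<n} ‖z k − z (k+1)‖ ≤ B: ‖G(0)‖ ≤ xiGrowthBound((1+e²)·B) · exp(−2(n+1)), where
xiGrowthBound r = 8e⁶·exp(4(½+√r)·log(3/2+√r)). Proof plan: all z k and 0 lie in the convex set K =
closedBall 0 B; Cauchy on spheres of radius e²B around points of K bounds ‖G⁽ⁿ⁺¹⁾‖ on K by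
(n+1)!·Γ/(e²B)ⁿ⁺¹ with Γ = sup of ‖G‖ on ‖v‖ ≤ (1+e²)B ≤ xiGrowthBound((1+e²)B) (‖½+√v‖ ≤ ½+√r,
log(1+‖s‖) ≤ log(3/2+√r), re(½+√v) ≥ ½ on the principal branch); Gontcharoff gives ‖G 0‖ ≤
(n+1)!Γ/(e²B)ⁿ⁺¹ · Bⁿ⁺¹/(n+1)! = Γ·e^{−2(n+1)}. [difficulty: M] -/
@[route_item "route-RiemannHypothesis-JensenChainBand", crux]
def XiSqChainAnchor : Prop :=
  ∀ (n : ℕ) (z : ℕ → ℂ), Summit.RiemannHypothesis.RiemannHypothesis.Theorems.JensenPolynomials.IsXiSqChain n z → ∀ B : ℝ, Summit.RiemannHypothesis.RiemannHypothesis.Theorems.JensenPolynomials.chainPath n z ≤ B → 0 < B → ‖Literature.NumberTheory.LFunctions.xiSq 0‖ ≤ Summit.RiemannHypothesis.RiemannHypothesis.Theorems.JensenPolynomials.xiGrowthBound ((1 + Real.exp 2) * B) * Real.exp (-(2 * ((n : ℝ) + 1)))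

/-- item stmt-RiemannHypothesis-19930 · crux · rank 3 · closed · moot by None · by planner
why it might fail: float margin is 1573 nats at n = 20000 (the minimum over n ≥ 20000; first true at n = 16108) and ≥ 0.55·n asymptotically (coefficient 4·√(1+e²)/8 = 1.448 < 2); it fails only if a prover's interval bounds for log/√ at n ≍ 2·10⁴ lose > 1500 nats — i.e. not mathematically, only by clumsy typing.
sources: KiKim2000, KimLee2021
[crux] THE BUDGET (closed numeric inequality, no ξ inside): for every n ≥ 20000,
xiGrowthBound((1+e²)·chainSpan n (chainRadius n)) · exp(−2(n+1)) < 2/5, where chainRadius n = (n/log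
n)²/64 and chainSpan n t = (1+√n+√t)(2(1+√n)+√t). In logs: log 8 + 6 + 4(½+√r)log(3/2+√r) − 2(n+1) <
log(2/5) with √r = √(1+e²)·√((1+√n+√R)(2+2√n+√R)), √R = (n/log n)/8. [difficulty: S] -/
@[route_item "route-RiemannHypothesis-JensenChainBand", crux]
def XiSqChainBudget : Prop :=
  ∀ n : ℕ, 20000 ≤ n → Summit.RiemannHypothesis.RiemannHypothesis.Theorems.JensenPolynomials.xiGrowthBound ((1 + Real.exp 2) * Summit.RiemannHypothesis.RiemannHypothesis.Theorems.JensenPolynomials.chainSpan n (Summit.RiemannHypothesis.RiemannHypothesis.Theorems.JensenPolynomials.chainRadius n)) * Real.exp (-(2 * ((n : ℝ) + 1))) < 2 / 5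

/-- item stmt-RiemannHypothesis-19935 · aside · rank 0 · closed · moot by None · by planner
sources: KimLee2021
[aside] S-RESTRICTED CASE for the tribunal's T3 (banked context, never staffed, never progress): the
leaf's row n = 300000 — every d with 20·√d·log 300000 ≤ 300000 (d ≤ 1.41·10⁶, beyond the
kernel-known regime d ≤ 10⁶ of `jensenPoly_xiTaylorCoeff_splits_allShifts_of_le_1e6'`) has
J^{d,300000}_γ hyperbolic; not provable today, implied by the leaf; paired with the plan-only rung
`stub_budgetAt300000` (BC3 skeleton of XiSqChainBudget). Sources: KimLee2021. -/
@[route_item "route-RiemannHypothesis-JensenChainBand"]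
def JensenSqrtLogRowCase : Prop :=
  ∀ d : ℕ, 20 * Real.sqrt d * Real.log 300000 ≤ 300000 → (Literature.NumberTheory.LFunctions.jensenPoly Literature.NumberTheory.LFunctions.xiTaylorCoeff d 300000).Splits

/-- item stmt-RiemannHypothesis-19931 · support · rank 9 · closed · moot by None · by planner
sources: KiKim2000, CravenCsordasSmith1987
[support] EVERY NON-REAL ZERO OF G⁽ⁿ⁾ ENDS A SHORT CHAIN: if G⁽ⁿ⁾(w) = 0 and Im w ≠ 0 then there is
z : ℕ → ℂ with G⁽ᵏ⁾(z k) = 0 (k ≤ n) and ‖z 0‖ + Σ_{k<n}‖z k − z (k+1)‖ ≤ chainSpan n ‖w‖. Proof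
plan (80 % already sorry-free in rh-jensen-idea-2/NegationLensSketch.lean
`xiDerivZerosNearReal_holds`): WLOG Im w > 0 (else conjugate, `xiSq_conj`); `exists_jensen_chain`
(hyps: `differentiable_xiSq`, `norm_xiSq_le`, `xiSq_ofReal_im`, `iteratedDeriv_xiSq_ne_zero`) gives
the chain ending at w; `chain_variation_le` gives V ≤ Im z₀·(1+√n); Im z₀ ≤ √‖z₀‖
(`abs_im_le_sqrt_norm_of_xiSq_eq_zero`); ‖z₀‖ ≤ ‖w‖ + V; with s = 1+√n, t = ‖w‖, q = √‖z₀‖: q² ≤ t +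
s·q ⇒ q ≤ s + √t ⇒ path = q² + V ≤ (s+√t)(2s+√t). [difficulty: M] -/
@[route_item "route-RiemannHypothesis-JensenChainBand", crux]
def XiSqNonrealZeroChain : Prop :=
  ∀ (n : ℕ) (w : ℂ), iteratedDeriv n Literature.NumberTheory.LFunctions.xiSq w = 0 → w.im ≠ 0 → ∃ z : ℕ → ℂ, Summit.RiemannHypothesis.RiemannHypothesis.Theorems.JensenPolynomials.IsXiSqChain n z ∧ Summit.RiemannHypothesis.RiemannHypothesis.Theorems.JensenPolynomials.chainPath n z ≤ Summit.RiemannHypothesis.RiemannHypothesis.Theorems.JensenPolynomials.chainSpan n ‖w‖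

/-- item stmt-RiemannHypothesis-19932 · support · rank 9 · closed · moot by None · by planner
sources: Polya1927Crelle, CsordasNorfolkVarga1986
[support] THE ANCHOR IS NOT SMALL: 2/5 ≤ ‖G(0)‖ = ‖ξ(½)‖ (true value 0.49712…; ξ(½) =
−Γ(¼)ζ(½)/(8π^{1/4}), or ξ(½) = 8∫₀^∞Φ(t)dt with the tree's kernel Φ; in tree today only
`riemannXi_half_re_pos`, `xiTaylorCoeff_zero_pos`). Kernel numerics: a certified lower Riemann sum
of Φ on [0, 1] (Φ is positive and decreasing), or interval bounds for Γ(¼) and ζ(½). [difficulty: M] -/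
@[route_item "route-RiemannHypothesis-JensenChainBand", crux]
def XiSqZeroLowerBound : Prop :=
  (2 : ℝ) / 5 ≤ ‖Literature.NumberTheory.LFunctions.xiSq 0‖

/-- item stmt-RiemannHypothesis-19933 · support · rank 9 · closed · proved by Summit.RiemannHypothesis.RiemannHypothesis.Theorems.JensenPolynomials.KimLee.wideBand_of_beyond (prover) · by planner
sources: KimLee2021, CravenCsordasSmith1987, GORZPNAS2019
[support] WIDE BAND FROM THE FLOOR (idea-2's kernel-checked `wideBand_of_beyond`, instantiated at R
= chainFloor; port job): if G⁽ⁿ⁾ has no non-real zero of norm < chainFloor n for every n, then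
J^{d,n}_γ splits over ℝ whenever 2d + (1+√n)·√(2d) ≤ chainFloor n (ingredients, all sorry-free on
HOME: real zeros of G⁽ⁿ⁾ are ≤ 0 — Laguerre/sector step `jensenShiftSector_holds`; the Jensen
polynomial of the shifted Taylor sequence is hyperbolic once the first d+1 relevant zeros are real —
`xiDerivZerosNearReal_holds`; `jensenPoly` rescaling by k!/8). [difficulty: M] -/
@[route_item "route-RiemannHypothesis-JensenChainBand", crux]
def JensenWideBandOfChainFloor : Prop :=
  Summit.RiemannHypothesis.RiemannHypothesis.Theorems.JensenPolynomials.XiDerivNonrealZeroBeyond Summit.RiemannHypothesis.RiemannHypothesis.Theorems.JensenPolynomials.chainFloor → Summit.RiemannHypothesis.RiemannHypothesis.Theorems.JensenPolynomials.JensenWideBandBelow Summit.RiemannHypothesis.RiemannHypothesis.Theorems.JensenPolynomials.chainFloor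

/-- `JensenWideBandOfChainFloor` holds: proved by `Summit.RiemannHypothesis.RiemannHypothesis.Theorems.JensenPolynomials.KimLee.wideBand_of_beyond`. -/
theorem JensenWideBandOfChainFloor_holds : JensenWideBandOfChainFloor := _root_.Summit.RiemannHypothesis.RiemannHypothesis.Theorems.JensenPolynomials.KimLee.wideBand_of_beyond

/-- item stmt-RiemannHypothesis-19934 · support · rank 9 · closed · moot by None · by planner
sources: KimLee2021
[support] LEAF ARITHMETIC: for n ≥ 20000 and 20·√d·log n ≤ n one has 2d + (1+√n)·√(2d) ≤ (n/log
n)²/64 (√d ≤ n/(20 log n); it suffices that 2/400 + √2(1+√n)·log n/(20n) ≤ 1/64, i.e. (1+√n)·log n ≤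
0.1503·n, true from n ≥ 2927; slack factor 2.25 at n = 20000). [difficulty: S] -/
@[route_item "route-RiemannHypothesis-JensenChainBand", crux]
def ChainBandArith : Prop :=
  ∀ d n : ℕ, 20000 ≤ n → 20 * Real.sqrt d * Real.log n ≤ n → 2 * (d : ℝ) + (1 + Real.sqrt n) * Real.sqrt (2 * d) ≤ Summit.RiemannHypothesis.RiemannHypothesis.Theorems.JensenPolynomials.chainRadius n

/-- item stmt-RiemannHypothesis-19936 · assembly · rank 1 · closed · moot by None · by planner
sources: KimLee2021, KiKim2000
[assembly] XiSqChainAnchor → XiSqChainBudget → XiSqNonrealZeroChain → XiSqZeroLowerBound →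
JensenWideBandOfChainFloor → ChainBandArith → the rung leaf JensenSqrtLogRangeTwenty -/
@[route_item "route-RiemannHypothesis-JensenChainBand"]
def Assembly : Prop :=
  XiSqChainAnchor → XiSqChainBudget → XiSqNonrealZeroChain → XiSqZeroLowerBound → JensenWideBandOfChainFloor → ChainBandArith → Summit.RiemannHypothesis.RiemannHypothesis.Theorems.JensenPolynomials.JensenSqrtLogRangeTwenty

/-! D-0027 §2.1 — DECIDING THEOREM (planner-authored via `route open/edit --closes-file`; by planner-rh-jensen-theory-g9-0 2026-08-26T21:22:45Z) — ARCHIVED: route closed (proved) 2026-08-26T22:03:33Z; kept so importers keep building: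
its hypotheses are this route's items and its conclusion the registered leaf `Summit.RiemannHypothesis.RiemannHypothesis.Theorems.JensenPolynomials.JensenSqrtLogRangeTwenty` (rung J-P(P1''), D-0061) (glue_lint), and it elaborates with this file. -/

@[closes "route-RiemannHypothesis-JensenChainBand"] theorem closes (hA : XiSqChainAnchor) (hB : XiSqChainBudget) (hC : XiSqNonrealZeroChain) (h0 : XiSqZeroLowerBound)
    (hW : JensenWideBandOfChainFloor) (hR : ChainBandArith) :
    Summit.RiemannHypothesis.RiemannHypothesis.Theorems.JensenPolynomials.JensenSqrtLogRangeTwenty := by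
  have hfloor : Summit.RiemannHypothesis.RiemannHypothesis.Theorems.JensenPolynomials.XiDerivNonrealZeroBeyond
      Summit.RiemannHypothesis.RiemannHypothesis.Theorems.JensenPolynomials.chainFloor := by
    intro n w hw him
    by_cases hn : 20000 ≤ n
    · rw [Summit.RiemannHypothesis.RiemannHypothesis.Theorems.JensenPolynomials.chainFloor_of_le hn]
      by_contra hlt
      rw [not_le] at hlt
      obtain ⟨z, hz, hP⟩ := hC n w hw him
      have hs : 0 ≤ Real.sqrt (n : ℝ) := Real.sqrt_nonneg _
      have ht : Real.sqrt ‖w‖ ≤ Real.sqrt (Summit.RiemannHypothesis.RiemannHypothesis.Theorems.JensenPolynomials.chainRadius n) :=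
        Real.sqrt_le_sqrt hlt.le
      have ht0 : 0 ≤ Real.sqrt ‖w‖ := Real.sqrt_nonneg _
      have hmono : Summit.RiemannHypothesis.RiemannHypothesis.Theorems.JensenPolynomials.chainSpan n ‖w‖ ≤
          Summit.RiemannHypothesis.RiemannHypothesis.Theorems.JensenPolynomials.chainSpan n
            (Summit.RiemannHypothesis.RiemannHypothesis.Theorems.JensenPolynomials.chainRadius n) := by
        unfold Summit.RiemannHypothesis.RiemannHypothesis.Theorems.JensenPolynomials.chainSpan
        apply mul_le_mul <;> nlinarith
      have hBpos : 0 < Summit.RiemannHypothesis.RiemannHypothesis.Theorems.JensenPolynomials.chainSpan n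
          (Summit.RiemannHypothesis.RiemannHypothesis.Theorems.JensenPolynomials.chainRadius n) := by
        unfold Summit.RiemannHypothesis.RiemannHypothesis.Theorems.JensenPolynomials.chainSpan
        have := Real.sqrt_nonneg (Summit.RiemannHypothesis.RiemannHypothesis.Theorems.JensenPolynomials.chainRadius n)
        positivity
      have h1 := hA n z hz _ (hP.trans hmono) hBpos
      have h2 := hB n hn
      have h3 : (2 : ℝ) / 5 ≤ ‖Literature.NumberTheory.LFunctions.xiSq 0‖ := h0
      linarith
    · rw [Summit.RiemannHypothesis.RiemannHypothesis.Theorems.JensenPolynomials.chainFloor_of_lt (Nat.lt_of_not_le hn)]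
      exact norm_nonneg _
  intro d n hn hdn
  have h := hW hfloor d n
  rw [Summit.RiemannHypothesis.RiemannHypothesis.Theorems.JensenPolynomials.chainFloor_of_le hn] at h
  exact h (hR d n hn hdn)

end Summit.RiemannHypothesis.RiemannHypothesis.Theses.JensenChainBand
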